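import Summits.QuantumFields.YangMills.Theorems.BalabanUVNodesN19SingleModeMultiscale
import Summits.QuantumFields.YangMills.Theorems.BalabanUVNodesN19CoefficientMassPricing

/-!
# YM-DAG node N19 (= NE7 proper) — MULTISCALE TELESCOPING, PART 8a: THE LADDER WITH COEFFICIENT MASS (the additive Jackson approximant with
# mass, the multiplicative step with mass, the telescoping ladder with mass — the moment-currency machinery for PART 8b)

Cell `pub-ymgap`, HUMAN RULING D-0062 (Track A) ∕ D-0149 (work-bound push), R141 (C) wider-strategy seat `pub-ymgap-dag-n19-e` (strategy
s3 = ALTERNATIVE CURRENCY), generation g30, module 11 (lineage module 128).  Route `Summits/QuantumFields/YangMills/Theses/BalabanUVNodes.lean`,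
cluster item K3⁸ «SpineGivenEndpointR13SepCoPHV» (stmt-QuantumFields-27366); filed `--supports` that item `--as helper` (it proves no registered
stub).  COUNT-NEUTRAL: [folklore] over Mathlib and the lineage BY NAME — PART 1 `…N19SingleModeMultiscale` (complex bookkeeping), module 127
`…N19CoefficientMassPricing` (`mass_*`), module 111 `…N19JointLawPriceCompositionsLipschitz` (`exists_jacksonPoly_near`: Jackson polynomials WITH
coefficient mass `≤ G·m9^m`); no laws in this part; no scheme object, no Theses import; NOT a discharge claim.

CONTENT.  The degree-model ladder of PARTS 1∕2 re-run with MASS bookkeeping, for PART 8b (`…N19SingleModeMomentCurrency`: the single mode of the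
ℓ¹-norm in the lineage's UNIFORM MIXED-MOMENT currency).  §1 `mass_X_le` · `mass_plantX_le` · `exists_additiveJackson_mass` (`A_M = Σ_i p_M(X_i)`:
`|S − A_M| ≤ dπ∕M`, mass `≤ d·M9^M`) · `eval_scaledCoeffSum` · ★ `exists_pair_mul_step_mass` (ONE STEP: the Jackson pair of `u ↦ e^{iωRu}` (degree `2m`,
error `ωRπ∕m` each, mass `m9^m`) planted in `B∕R` has mass `≤ m9^m(m_B∕R)^{2m}`; the new pair has masses `≤ 2M·m9^m(m_B∕R)^{2m}` and error
`ε + (1+ε)·2ωRπ∕m`) · §2 ★ `exists_pair_near_cexp_sum_mass` (THE LADDER: masses `≤ ∏_l 2m_l9^{m_l}(m_B(l)∕R_l)^{2m_l}`, error `≤ 2Σ_l 2ωR_lπ∕m_l`).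

HONEST FRAMING (binding).  Elementary and [folklore]; NO consumer in the DAG today (the seat's own currency map); nothing of Bałaban's instantiated;
NE7 NOT PRINTED, NOT proved; N19 NOT discharged; count-neutral.  One finite `T⁴` programme at fixed `ε`; nothing continuum ∕ `ℝ⁴` ∕ OS ∕ mass-gap ∕
Clay.  0 `def` ∕ 0 `sorry`.
-/


noncomputable section

open Real Finset MeasureTheory Complex

namespace Summit.QuantumFields.YangMills.Theorems.BalabanUVNodesN19SingleModeMomentLadder

open Summit.QuantumFields.YangMills.Theorems.BalabanUVNodesN19SingleModeMultiscale (norm_cexp_sub_cexp_le)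
open Summit.QuantumFields.YangMills.Theorems.BalabanUVNodesN19CoefficientMassPricing
open Summit.QuantumFields.YangMills.Theorems.BalabanUVNodesN19JointLawPriceCompositionsLipschitz (exists_jacksonPoly_near)
open Summit.QuantumFields.YangMills.Theorems.BalabanUVNodesN19JointLawPriceDimension (abs_integral_le_of_cube)
open Summit.QuantumFields.YangMills.Theorems.BalabanUVNodesN19JointLawBernstein (integrable_of_continuous_of_cube)

variable {ι : Type*} [Fintype ι]

/-! ## §1 The Jackson ladder and the multiplicative step, with coefficient mass [folklore] -/

omit [Fintype ι] in
/-- `mass(X_i) ≤ 1`. [bookkeeping] -/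
theorem mass_X_le (i : ι) :
    ∑ s ∈ (MvPolynomial.X i : MvPolynomial ι ℝ).support, |(MvPolynomial.X i : MvPolynomial ι ℝ).coeff s| ≤ 1 := by
  have h := mass_monomial_le (ι := ι) (Finsupp.single i 1) 1
  rw [abs_one, ← MvPolynomial.X_pow_eq_monomial, pow_one] at h
  exact h

omit [Fintype ι] in
/-- A univariate `q` planted in `X_i` has mass `≤ Σ_k|q_k|`. [bookkeeping] -/
theorem mass_plantX_le (q : Polynomial ℝ) (i : ι) :
    ∑ s ∈ (∑ k ∈ range (q.natDegree + 1), MvPolynomial.C (q.coeff k) * (MvPolynomial.X i) ^ k).support,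
        |(∑ k ∈ range (q.natDegree + 1), MvPolynomial.C (q.coeff k) * (MvPolynomial.X i) ^ k).coeff s| ≤
      ∑ k ∈ range (q.natDegree + 1), |q.coeff k| := by
  refine (mass_coeffSum_le (fun k => q.coeff k) (MvPolynomial.X i) _).trans (Finset.sum_le_sum fun k _ => ?_)
  calc |q.coeff k| * (∑ s ∈ (MvPolynomial.X i : MvPolynomial ι ℝ).support, |(MvPolynomial.X i : MvPolynomial ι ℝ).coeff s|) ^ k
      ≤ |q.coeff k| * 1 :=
        mul_le_mul_of_nonneg_left (pow_le_one₀ (Finset.sum_nonneg fun s _ => abs_nonneg _) (mass_X_le i)) (abs_nonneg _)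
    _ = |q.coeff k| := mul_one _

/-- **THE ADDITIVE JACKSON APPROXIMANT WITH MASS.**  For `M ≥ 1` there is `A : MvPolynomial ι ℝ` with `|Σ_i|x_i| − A(x)| ≤ dπ∕M` on `[−1,1]^ι` and
coefficient mass `≤ d·M9^M` (module 111's Jackson polynomial of `|·|`, mass `≤ M9^M`, planted in each `X_i`, `mass X_i = 1`). [folklore] -/
theorem exists_additiveJackson_mass {M : ℕ} (hM : 0 < M) :
    ∃ A : MvPolynomial ι ℝ, (∑ s ∈ A.support, |A.coeff s|) ≤ Fintype.card ι * (M * 9 ^ M) ∧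
      ∀ x : ι → ℝ, (∀ i, x i ∈ Set.Icc (-1 : ℝ) 1) →
        |(∑ i, |x i|) - MvPolynomial.eval x A| ≤ Fintype.card ι * (π / M) := by
  classical
  have hK : ∀ u v : ℝ, u ∈ Set.Icc (-1 : ℝ) 1 → v ∈ Set.Icc (-1 : ℝ) 1 → |abs u - abs v| ≤ 1 * |u - v| :=
    fun u v _ _ => by rw [one_mul]; exact abs_abs_sub_abs_le_abs_sub u v
  have hG : ∀ u : ℝ, u ∈ Set.Icc (-1 : ℝ) 1 → |abs u| ≤ 1 := fun u hu => by
    rw [abs_abs]; exact abs_le.2 ⟨hu.1, hu.2⟩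
  obtain ⟨q, -, hqerr, hqmass, -⟩ := exists_jacksonPoly_near zero_le_one hK hG hM
  refine ⟨∑ i, ∑ k ∈ range (q.natDegree + 1), MvPolynomial.C (q.coeff k) * (MvPolynomial.X i) ^ k, ?_, ?_⟩
  · refine (mass_sum_le _ _).trans ?_
    have hterm : ∀ i : ι, (∑ s ∈ (∑ k ∈ range (q.natDegree + 1), MvPolynomial.C (q.coeff k) * (MvPolynomial.X i) ^ k).support,
        |(∑ k ∈ range (q.natDegree + 1), MvPolynomial.C (q.coeff k) * (MvPolynomial.X i) ^ k).coeff s|) ≤ (1 : ℝ) * ((M : ℝ) * 9 ^ M) :=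
      fun i => (mass_plantX_le q i).trans (hqmass _)
    calc _ ≤ ∑ _i : ι, (1 : ℝ) * ((M : ℝ) * 9 ^ M) := Finset.sum_le_sum fun i _ => hterm i
      _ = Fintype.card ι * (M * 9 ^ M) := by rw [sum_const, card_univ, nsmul_eq_mul, one_mul]
  · intro x hx
    have hsum : MvPolynomial.eval x (∑ i, ∑ k ∈ range (q.natDegree + 1), MvPolynomial.C (q.coeff k) * (MvPolynomial.X i) ^ k) =
        ∑ i, q.eval (x i) := by
      rw [map_sum]
      refine Finset.sum_congr rfl fun i _ => ?_
      rw [map_sum, Polynomial.eval_eq_sum_range]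
      exact Finset.sum_congr rfl fun k _ => by rw [map_mul, MvPolynomial.eval_C, map_pow, MvPolynomial.eval_X]
    rw [hsum, ← Finset.sum_sub_distrib]
    calc |∑ i, (|x i| - q.eval (x i))| ≤ ∑ i, |(|x i| - q.eval (x i))| := abs_sum_le_sum_abs _ _
      _ ≤ ∑ _i : ι, 1 * (π / M) := Finset.sum_le_sum fun i _ => hqerr _ (hx i)
      _ = Fintype.card ι * (π / M) := by rw [sum_const, card_univ, nsmul_eq_mul, one_mul]

omit [Fintype ι] in
/-- `Σ_k C(q_k R^{−k})·B^k` evaluates to `q(B(x)∕R)`. [bookkeeping] -/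
theorem eval_scaledCoeffSum (q : Polynomial ℝ) (R : ℝ) (B : MvPolynomial ι ℝ) (x : ι → ℝ) :
    MvPolynomial.eval x (∑ k ∈ range (q.natDegree + 1), MvPolynomial.C (q.coeff k * R⁻¹ ^ k) * B ^ k) =
      q.eval (MvPolynomial.eval x B / R) := by
  rw [map_sum, Polynomial.eval_eq_sum_range]
  refine Finset.sum_congr rfl fun k _ => ?_
  rw [map_mul, MvPolynomial.eval_C, map_pow, div_eq_mul_inv, mul_pow]
  ring

omit [Fintype ι] in
/-- ★ **ONE STEP, WITH MASS.**  Let `(Cr, Ci)` have coefficient masses `≤ M` and `‖Cr(x) + Ci(x)·i − e^{iθ(x)}‖ ≤ ε` on the cube (`0 ≤ ε`); let `B`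
have mass `≤ m_B` and `|B| ≤ R` on the cube with `0 < R ≤ m_B`; `ω ≥ 0`, `m ≥ 1`.  With module 111's Jackson pair `(q_c, q_s)` of `u ↦ e^{iωRu}`
(error `ωRπ∕m` each, mass `≤ m9^m`) planted in `B∕R`: the pair `(Cr·Qc − Ci·Qs, Cr·Qs + Ci·Qc)` has masses `≤ 2M·m9^m(m_B∕R)^{2m}` and error
`≤ ε + (1+ε)·2ωRπ∕m`. [folklore] -/
theorem exists_pair_mul_step_mass {θ : (ι → ℝ) → ℝ} {Cr Ci B : MvPolynomial ι ℝ} {M mB R ε ω : ℝ} {m : ℕ}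
    (hCr : (∑ s ∈ Cr.support, |Cr.coeff s|) ≤ M) (hCi : (∑ s ∈ Ci.support, |Ci.coeff s|) ≤ M)
    (hBm : (∑ s ∈ B.support, |B.coeff s|) ≤ mB) (hR : 0 < R) (hRm : R ≤ mB) (hε : 0 ≤ ε)
    (happ : ∀ x : ι → ℝ, (∀ i, x i ∈ Set.Icc (-1 : ℝ) 1) →
      ‖((MvPolynomial.eval x Cr : ℝ) : ℂ) + ((MvPolynomial.eval x Ci : ℝ) : ℂ) * I - exp ((θ x : ℂ) * I)‖ ≤ ε)
    (hBR : ∀ x : ι → ℝ, (∀ i, x i ∈ Set.Icc (-1 : ℝ) 1) → |MvPolynomial.eval x B| ≤ R) (hω : 0 ≤ ω) (hm : 0 < m) :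
    ∃ Cr' Ci' : MvPolynomial ι ℝ,
      (∑ s ∈ Cr'.support, |Cr'.coeff s|) ≤ 2 * M * ((m : ℝ) * 9 ^ m * (mB / R) ^ (2 * m)) ∧
      (∑ s ∈ Ci'.support, |Ci'.coeff s|) ≤ 2 * M * ((m : ℝ) * 9 ^ m * (mB / R) ^ (2 * m)) ∧
      ∀ x : ι → ℝ, (∀ i, x i ∈ Set.Icc (-1 : ℝ) 1) →
        ‖((MvPolynomial.eval x Cr' : ℝ) : ℂ) + ((MvPolynomial.eval x Ci' : ℝ) : ℂ) * I -
            exp (((θ x + ω * MvPolynomial.eval x B : ℝ) : ℂ) * I)‖ ≤ ε + (1 + ε) * (2 * ω * R * π / m) := by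
  -- the Jackson pair of `u ↦ cos(ωRu)`, `u ↦ sin(ωRu)` on `[-1,1]`
  have hK0 : 0 ≤ ω * R := mul_nonneg hω hR.le
  have hKc : ∀ u v : ℝ, u ∈ Set.Icc (-1 : ℝ) 1 → v ∈ Set.Icc (-1 : ℝ) 1 →
      |Real.cos (ω * R * u) - Real.cos (ω * R * v)| ≤ ω * R * |u - v| := fun u v _ _ => by
    refine (Real.abs_cos_sub_cos_le _ _).trans ?_
    rw [← mul_sub, abs_mul, abs_of_nonneg hK0]
  have hKs : ∀ u v : ℝ, u ∈ Set.Icc (-1 : ℝ) 1 → v ∈ Set.Icc (-1 : ℝ) 1 →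
      |Real.sin (ω * R * u) - Real.sin (ω * R * v)| ≤ ω * R * |u - v| := fun u v _ _ => by
    refine (Real.abs_sin_sub_sin_le _ _).trans ?_
    rw [← mul_sub, abs_mul, abs_of_nonneg hK0]
  have hGc : ∀ u : ℝ, u ∈ Set.Icc (-1 : ℝ) 1 → |Real.cos (ω * R * u)| ≤ 1 := fun u _ => Real.abs_cos_le_one _
  have hGs : ∀ u : ℝ, u ∈ Set.Icc (-1 : ℝ) 1 → |Real.sin (ω * R * u)| ≤ 1 := fun u _ => Real.abs_sin_le_one _
  obtain ⟨qc, hqc_deg, hqc_err, hqc_mass, -⟩ := exists_jacksonPoly_near hK0 hKc hGc hm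
  obtain ⟨qs, hqs_deg, hqs_err, hqs_mass, -⟩ := exists_jacksonPoly_near hK0 hKs hGs hm
  set Qc : MvPolynomial ι ℝ := ∑ k ∈ range (qc.natDegree + 1), MvPolynomial.C (qc.coeff k * R⁻¹ ^ k) * B ^ k with hQc
  set Qs : MvPolynomial ι ℝ := ∑ k ∈ range (qs.natDegree + 1), MvPolynomial.C (qs.coeff k * R⁻¹ ^ k) * B ^ k with hQs
  -- masses of the planted pair
  have hρ : 1 ≤ mB / R := by rw [le_div_iff₀ hR, one_mul]; exact hRm
  have hmass_planted : ∀ (q : Polynomial ℝ), q.natDegree ≤ 2 * m → (∀ e : ℕ, ∑ k ∈ range (e + 1), |q.coeff k| ≤ 1 * (m * 9 ^ m)) →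
      (∑ s ∈ (∑ k ∈ range (q.natDegree + 1), MvPolynomial.C (q.coeff k * R⁻¹ ^ k) * B ^ k).support,
        |(∑ k ∈ range (q.natDegree + 1), MvPolynomial.C (q.coeff k * R⁻¹ ^ k) * B ^ k).coeff s|) ≤
        (m : ℝ) * 9 ^ m * (mB / R) ^ (2 * m) := by
    intro q hqdeg hqmass
    refine (mass_coeffSum_le (fun k => q.coeff k * R⁻¹ ^ k) B _).trans ?_
    have hB0 : 0 ≤ ∑ s ∈ B.support, |B.coeff s| := Finset.sum_nonneg fun s _ => abs_nonneg _
    calc ∑ j ∈ range (q.natDegree + 1), |q.coeff j * R⁻¹ ^ j| * (∑ s ∈ B.support, |B.coeff s|) ^ j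
        ≤ ∑ j ∈ range (q.natDegree + 1), |q.coeff j| * (mB / R) ^ (2 * m) := by
          refine Finset.sum_le_sum fun j hj => ?_
          have hj' : j ≤ 2 * m := (Nat.lt_succ_iff.1 (mem_range.1 hj)).trans hqdeg
          rw [abs_mul, abs_pow, abs_inv, abs_of_pos hR, mul_assoc]
          refine mul_le_mul_of_nonneg_left ?_ (abs_nonneg _)
          calc R⁻¹ ^ j * (∑ s ∈ B.support, |B.coeff s|) ^ j = ((∑ s ∈ B.support, |B.coeff s|) / R) ^ j := by
                rw [div_eq_mul_inv, mul_pow]; ring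
            _ ≤ (mB / R) ^ j := pow_le_pow_left₀ (by positivity) (div_le_div_of_nonneg_right hBm hR.le) j
            _ ≤ (mB / R) ^ (2 * m) := pow_le_pow_right₀ hρ hj'
      _ = (∑ j ∈ range (q.natDegree + 1), |q.coeff j|) * (mB / R) ^ (2 * m) := by rw [Finset.sum_mul]
      _ ≤ 1 * (m * 9 ^ m) * (mB / R) ^ (2 * m) := mul_le_mul_of_nonneg_right (hqmass _) (by positivity)
      _ = (m : ℝ) * 9 ^ m * (mB / R) ^ (2 * m) := by ring
  have hQc_mass := hmass_planted qc hqc_deg hqc_mass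
  have hQs_mass := hmass_planted qs hqs_deg hqs_mass
  rw [← hQc] at hQc_mass
  rw [← hQs] at hQs_mass
  set μ : ℝ := (m : ℝ) * 9 ^ m * (mB / R) ^ (2 * m) with hμ
  have hμ0 : 0 ≤ μ := by positivity
  have hM0 : 0 ≤ M := (Finset.sum_nonneg fun s _ => abs_nonneg _).trans hCr
  refine ⟨Cr * Qc - Ci * Qs, Cr * Qs + Ci * Qc, ?_, ?_, ?_⟩
  · calc _ ≤ _ := mass_sub_le _ _
      _ ≤ M * μ + M * μ := add_le_add ((mass_mul_le _ _).trans (mul_le_mul hCr hQc_mass (Finset.sum_nonneg fun s _ => abs_nonneg _) hM0))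
          ((mass_mul_le _ _).trans (mul_le_mul hCi hQs_mass (Finset.sum_nonneg fun s _ => abs_nonneg _) hM0))
      _ = 2 * M * μ := by ring
  · calc _ ≤ _ := mass_add_le _ _
      _ ≤ M * μ + M * μ := add_le_add ((mass_mul_le _ _).trans (mul_le_mul hCr hQs_mass (Finset.sum_nonneg fun s _ => abs_nonneg _) hM0))
          ((mass_mul_le _ _).trans (mul_le_mul hCi hQc_mass (Finset.sum_nonneg fun s _ => abs_nonneg _) hM0))
      _ = 2 * M * μ := by ring
  · intro x hx
    set b : ℝ := MvPolynomial.eval x B with hb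
    set z : ℂ := ((MvPolynomial.eval x Cr : ℝ) : ℂ) + ((MvPolynomial.eval x Ci : ℝ) : ℂ) * I with hz
    set w : ℂ := ((MvPolynomial.eval x Qc : ℝ) : ℂ) + ((MvPolynomial.eval x Qs : ℝ) : ℂ) * I with hw
    have hprod : ((MvPolynomial.eval x (Cr * Qc - Ci * Qs) : ℝ) : ℂ) +
        ((MvPolynomial.eval x (Cr * Qs + Ci * Qc) : ℝ) : ℂ) * I = z * w := by
      simp only [map_sub, map_add, map_mul, hz, hw]
      push_cast
      linear_combination (-((MvPolynomial.eval x Ci : ℝ) : ℂ) * ((MvPolynomial.eval x Qs : ℝ) : ℂ)) * Complex.I_mul_I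
    -- `w` is within `2ωRπ/m` of `e^{iωb}`
    have hu : b / R ∈ Set.Icc (-1 : ℝ) 1 := by
      have := hBR x hx
      rw [← hb] at this
      constructor
      · rw [le_div_iff₀ hR]; linarith [(abs_le.1 this).1]
      · rw [div_le_iff₀ hR]; linarith [(abs_le.1 this).2]
    have hQc_ev : MvPolynomial.eval x Qc = qc.eval (b / R) := by rw [hQc, eval_scaledCoeffSum]
    have hQs_ev : MvPolynomial.eval x Qs = qs.eval (b / R) := by rw [hQs, eval_scaledCoeffSum]
    have hωb : ω * R * (b / R) = ω * b := by field_simp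
    have hwerr : ‖w - exp (((ω * b : ℝ) : ℂ) * I)‖ ≤ 2 * ω * R * π / m := by
      have ec := hqc_err _ hu
      have es := hqs_err _ hu
      rw [hωb] at ec es
      have hre : (w - exp (((ω * b : ℝ) : ℂ) * I)).re = qc.eval (b / R) - Real.cos (ω * b) := by
        rw [hw, hQc_ev, hQs_ev]
        simp only [Complex.sub_re, Complex.add_re, Complex.mul_re, Complex.ofReal_re, Complex.ofReal_im, Complex.I_re,
          Complex.I_im, Complex.exp_ofReal_mul_I_re]
        ring
      have him : (w - exp (((ω * b : ℝ) : ℂ) * I)).im = qs.eval (b / R) - Real.sin (ω * b) := by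
        rw [hw, hQc_ev, hQs_ev]
        simp only [Complex.sub_im, Complex.add_im, Complex.mul_im, Complex.ofReal_re, Complex.ofReal_im, Complex.I_re,
          Complex.I_im, Complex.exp_ofReal_mul_I_im]
        ring
      calc ‖w - exp (((ω * b : ℝ) : ℂ) * I)‖
          ≤ |(w - exp (((ω * b : ℝ) : ℂ) * I)).re| + |(w - exp (((ω * b : ℝ) : ℂ) * I)).im| := Complex.norm_le_abs_re_add_abs_im _
        _ ≤ ω * R * (π / m) + ω * R * (π / m) := by
            rw [hre, him, abs_sub_comm, abs_sub_comm (qs.eval (b / R))]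
            exact add_le_add ec es
        _ = 2 * ω * R * π / m := by ring
    have hzerr : ‖z - exp ((θ x : ℂ) * I)‖ ≤ ε := happ x hx
    have hz1 : ‖z‖ ≤ 1 + ε := by
      calc ‖z‖ = ‖exp ((θ x : ℂ) * I) + (z - exp ((θ x : ℂ) * I))‖ := by rw [add_sub_cancel]
        _ ≤ ‖exp ((θ x : ℂ) * I)‖ + ‖z - exp ((θ x : ℂ) * I)‖ := norm_add_le _ _
        _ ≤ 1 + ε := by rw [Complex.norm_exp_ofReal_mul_I]; exact add_le_add le_rfl hzerr
    have harg : ((θ x + ω * b : ℝ) : ℂ) * I = (θ x : ℂ) * I + ((ω * b : ℝ) : ℂ) * I := by push_cast; ring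
    have hexp : exp (((θ x + ω * b : ℝ) : ℂ) * I) = exp ((θ x : ℂ) * I) * exp (((ω * b : ℝ) : ℂ) * I) := by
      rw [harg, Complex.exp_add]
    rw [hprod, hexp]
    have hsplit : z * w - exp ((θ x : ℂ) * I) * exp (((ω * b : ℝ) : ℂ) * I) =
        z * (w - exp (((ω * b : ℝ) : ℂ) * I)) + (z - exp ((θ x : ℂ) * I)) * exp (((ω * b : ℝ) : ℂ) * I) := by ring
    rw [hsplit]
    have hη0 : 0 ≤ 2 * ω * R * π / m := by positivity
    calc ‖z * (w - exp (((ω * b : ℝ) : ℂ) * I)) + (z - exp ((θ x : ℂ) * I)) * exp (((ω * b : ℝ) : ℂ) * I)‖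
        ≤ ‖z * (w - exp (((ω * b : ℝ) : ℂ) * I))‖ + ‖(z - exp ((θ x : ℂ) * I)) * exp (((ω * b : ℝ) : ℂ) * I)‖ := norm_add_le _ _
      _ = ‖z‖ * ‖w - exp (((ω * b : ℝ) : ℂ) * I)‖ + ‖z - exp ((θ x : ℂ) * I)‖ * 1 := by
          rw [norm_mul, norm_mul, Complex.norm_exp_ofReal_mul_I]
      _ ≤ (1 + ε) * (2 * ω * R * π / m) + ε * 1 :=
          add_le_add (mul_le_mul hz1 hwerr (norm_nonneg _) (by linarith)) (mul_le_mul_of_nonneg_right hzerr zero_le_one)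
      _ = ε + (1 + ε) * (2 * ω * R * π / m) := by ring

/-! ## §2 ★ The ladder with mass [folklore] -/

omit [Fintype ι] in
/-- ★ **THE LADDER WITH MASS.**  Increments `B_l` with masses `≤ m_B(l)`, cube bounds `0 < R_l ≤ m_B(l)`, Jackson degrees `m_l ≥ 1`, base phase `φ₀`,
`ω ≥ 0`, and `Σ_{l<J} 2ωR_lπ∕m_l ≤ ½`: a pair `(Cr, Ci)` of masses `≤ ∏_{l<J} 2m_l9^{m_l}(m_B(l)∕R_l)^{2m_l}` with
`‖Cr(x) + Ci(x)·i − e^{i(φ₀ + ωΣ_{l<J}B_l(x))}‖ ≤ 2Σ_{l<J} 2ωR_lπ∕m_l` on `[−1,1]^ι`. [folklore] -/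
theorem exists_pair_near_cexp_sum_mass (φ₀ : ℝ) {ω : ℝ} (hω : 0 ≤ ω) (B : ℕ → MvPolynomial ι ℝ) (mB R : ℕ → ℝ) (m : ℕ → ℕ) :
    ∀ J : ℕ, (∀ l, l < J → (∑ s ∈ (B l).support, |(B l).coeff s|) ≤ mB l) →
      (∀ l, l < J → 0 < R l ∧ R l ≤ mB l) →
      (∀ l, l < J → ∀ x : ι → ℝ, (∀ i, x i ∈ Set.Icc (-1 : ℝ) 1) → |MvPolynomial.eval x (B l)| ≤ R l) →
      (∀ l, l < J → 0 < m l) →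
      (∑ l ∈ range J, 2 * ω * R l * π / m l) ≤ 1 / 2 →
      ∃ Cr Ci : MvPolynomial ι ℝ,
        (∑ s ∈ Cr.support, |Cr.coeff s|) ≤ ∏ l ∈ range J, 2 * ((m l : ℝ) * 9 ^ m l * (mB l / R l) ^ (2 * m l)) ∧
        (∑ s ∈ Ci.support, |Ci.coeff s|) ≤ ∏ l ∈ range J, 2 * ((m l : ℝ) * 9 ^ m l * (mB l / R l) ^ (2 * m l)) ∧
        ∀ x : ι → ℝ, (∀ i, x i ∈ Set.Icc (-1 : ℝ) 1) →
          ‖((MvPolynomial.eval x Cr : ℝ) : ℂ) + ((MvPolynomial.eval x Ci : ℝ) : ℂ) * I -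
              exp (((φ₀ + ω * ∑ l ∈ range J, MvPolynomial.eval x (B l) : ℝ) : ℂ) * I)‖ ≤
            2 * ∑ l ∈ range J, 2 * ω * R l * π / m l := by
  intro J
  induction J with
  | zero =>
    intro _ _ _ _ _
    refine ⟨MvPolynomial.C (Real.cos φ₀), MvPolynomial.C (Real.sin φ₀), ?_, ?_, ?_⟩
    · rw [prod_range_zero]; exact (mass_C_le _).trans (Real.abs_cos_le_one _)
    · rw [prod_range_zero]; exact (mass_C_le _).trans (Real.abs_sin_le_one _)
    · intro x _
      rw [MvPolynomial.eval_C, MvPolynomial.eval_C, sum_range_zero, sum_range_zero, mul_zero, add_zero, mul_zero]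
      have h0 : ((Real.cos φ₀ : ℝ) : ℂ) + ((Real.sin φ₀ : ℝ) : ℂ) * I = exp ((φ₀ : ℂ) * I) := by
        rw [Complex.exp_mul_I, Complex.ofReal_cos, Complex.ofReal_sin]
      rw [h0, sub_self, norm_zero]
  | succ J ih =>
    intro hmass hR hBR hm hη
    have hηJ : 0 ≤ 2 * ω * R J * π / m J := by
      have := (hR J (Nat.lt_succ_self J)).1; positivity
    have hη' : ∑ l ∈ range J, 2 * ω * R l * π / m l ≤ 1 / 2 := by
      rw [Finset.sum_range_succ] at hη; linarith
    obtain ⟨Cr, Ci, hCr, hCi, happ⟩ := ih (fun l hl => hmass l (Nat.lt_succ_of_lt hl)) (fun l hl => hR l (Nat.lt_succ_of_lt hl))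
      (fun l hl => hBR l (Nat.lt_succ_of_lt hl)) (fun l hl => hm l (Nat.lt_succ_of_lt hl)) hη'
    have hsum0 : 0 ≤ ∑ l ∈ range J, 2 * ω * R l * π / m l :=
      Finset.sum_nonneg fun l hl => by have := (hR l (Nat.lt_succ_of_lt (mem_range.1 hl))).1; positivity
    have hε0 : 0 ≤ 2 * ∑ l ∈ range J, 2 * ω * R l * π / m l := by positivity
    have hε1 : 2 * ∑ l ∈ range J, 2 * ω * R l * π / m l ≤ 1 := by linarith
    obtain ⟨Cr', Ci', hCr', hCi', happ'⟩ :=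
      exists_pair_mul_step_mass (θ := fun x => φ₀ + ω * ∑ l ∈ range J, MvPolynomial.eval x (B l))
        hCr hCi (hmass J (Nat.lt_succ_self J)) (hR J (Nat.lt_succ_self J)).1 (hR J (Nat.lt_succ_self J)).2 hε0 happ
        (hBR J (Nat.lt_succ_self J)) hω (hm J (Nat.lt_succ_self J))
    refine ⟨Cr', Ci', ?_, ?_, ?_⟩
    · rw [Finset.prod_range_succ, mul_comm _ (2 * _), show (2 : ℝ) * ((m J : ℝ) * 9 ^ m J * (mB J / R J) ^ (2 * m J)) *
          ∏ l ∈ range J, 2 * ((m l : ℝ) * 9 ^ m l * (mB l / R l) ^ (2 * m l)) =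
        2 * (∏ l ∈ range J, 2 * ((m l : ℝ) * 9 ^ m l * (mB l / R l) ^ (2 * m l))) * ((m J : ℝ) * 9 ^ m J * (mB J / R J) ^ (2 * m J)) by ring]
      exact hCr'
    · rw [Finset.prod_range_succ, mul_comm _ (2 * _), show (2 : ℝ) * ((m J : ℝ) * 9 ^ m J * (mB J / R J) ^ (2 * m J)) *
          ∏ l ∈ range J, 2 * ((m l : ℝ) * 9 ^ m l * (mB l / R l) ^ (2 * m l)) =
        2 * (∏ l ∈ range J, 2 * ((m l : ℝ) * 9 ^ m l * (mB l / R l) ^ (2 * m l))) * ((m J : ℝ) * 9 ^ m J * (mB J / R J) ^ (2 * m J)) by ring]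
      exact hCi'
    · intro x hx
      have hphase : φ₀ + ω * ∑ l ∈ range (J + 1), MvPolynomial.eval x (B l) =
          (φ₀ + ω * ∑ l ∈ range J, MvPolynomial.eval x (B l)) + ω * MvPolynomial.eval x (B J) := by
        rw [Finset.sum_range_succ, mul_add, add_assoc]
      rw [hphase]
      refine (happ' x hx).trans ?_
      rw [Finset.sum_range_succ, mul_add]
      nlinarith

end Summit.QuantumFields.YangMills.Theorems.BalabanUVNodesN19SingleModeMomentLadder

end
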